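/-
  Summits/AtomisticToContinuum/Crystallization/Theorems/OverbindingBudgetAffineFarSlotRecord.lean

  residual stmt-AtomisticToContinuum-31280 · slot Z `FarAggregatePricing 12 (1/25) (1/2000) (1/(2·10⁷))`: the slot record after DRIFT is PROVED
  (…FarLabelDrift) — leaf list v13 (six leaves) — and the (β′) re-typing of critic row 866 (iv): `AffineChartStraightening'` (R_aff at frame
  tolerance `θ ≤ 1/25`) + bridge, the far leaves LAB / Zr‴a re-typed over it, and the seven-hypothesis record v13′.  decomp-a2c lens-4, generation 55.
  0 sorry · 0 axiom · no instance · no notation · no option.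
-/
import Summits.AtomisticToContinuum.Crystallization.Theorems.OverbindingBudgetAffineFarCensusCharge
import Summits.AtomisticToContinuum.Crystallization.Theorems.OverbindingBudgetAffineFarLabelDrift

/-! # Slot Z after DRIFT: leaf list v13, and the (β′) re-typing over `AffineChartStraightening'`

RECORDS (PROVED):
* ★ `farAggregatePricing_record_of_leaves_v13 : Z2 → Zr‴a → Zr‴b → Z3a → LAB → Z4″ → FarAggregatePricing 12 (1/25) (1/2000) (1/(2·10⁷))` — the v12″
  record of `…FarCensusCharge` with its DRIFT hypothesis discharged by `labelDriftBound_holds` (…FarLabelDrift).  LEAF LIST v13 = Z2 `FarCoreExcess` (CERT) ·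
  Zr‴a `ShelteredFarCharting` (M) · Zr‴b `NormalCorePricing` (S) · Z3a `TailDriftBound` (S/M) · LAB `ShelteredLabelling` (M, rank 2) · Z4″ `ScaleBadFloor`
  (M+CERT).
* (β′, critic row 866 (iv)) `AffineChartStraightening'` := the tree's R_aff `…OverbindingBudgetAffineLadder.AffineChartStraightening` VERBATIM except the
  frame tolerance range `θ ≤ 1/50 ↦ θ ≤ 1/25` (strictly STRONGER; TRUE-type by the same mechanism — two-shell frames are unambiguous while
  `3θ√2 ≈ 0.17 < 1/2`); the one-line bridge `affineChartStraightening_of_prime : AffineChartStraightening' → AffineChartStraightening`; the far leaves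
  re-typed over it so that their provers may USE straightening on the slot's good class `AffDeepReg 12 ε₁ (1/25) (1/450)`:
  `ShelteredLabelling' θ θ₀` / `ShelteredFarCharting' θ θ₀` := the tree bodies of LAB / Zr‴a VERBATIM behind the premise `AffineChartStraightening'`
  (instead of `AffineChartStraightening`), with both bridges (`…_of_prime : X' → AffineChartStraightening' → X`, `…'_of : X → X'`), and
  ★ `farAggregatePricing_record_of_leaves_v13' : AffineChartStraightening' → Z2 → Zr‴a′ → Zr‴b → Z3a → LAB′ → Z4″ → FarAggregatePricing 12 (1/25) (1/2000) (1/(2·10⁷))`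
  (seven hypotheses: the six leaves with LAB / Zr‴a primed, plus R_aff′ — the re-pointed R_aff work item, which the slot statement's own premise
  R_aff (θ ≤ 1/50) cannot supply).  Which list is of record (v13 or v13′) is the critic's ruling; both are typed here.
-/

namespace Summit.AtomisticToContinuum.Crystallization.Theorems.OverbindingBudgetAffineFarSmoothSplit

open scoped BigOperators Classical
open Literature.MathematicalPhysics.StatisticalMechanics
open Literature.Geometry.DiscreteGeometry (nearestDist fccTwoShellPattern hcpTwoShellPattern)
open Summit.AtomisticToContinuum.Crystallization.Theorems.OverbindingBudgetBalancedCensusStatements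
open Summit.AtomisticToContinuum.Crystallization.Theorems.OverbindingBudgetAffineLadder
open Summit.AtomisticToContinuum.Crystallization.Theorems.OverbindingBudgetAffineLocalisation

/-! ## §1  ★ Slot Z, leaf list v13 (DRIFT discharged) -/

/-- ★ **SLOT Z, LEAF LIST v13** (DRIFT `LabelDriftBound` PROVED, `labelDriftBound_holds`):
`FarCoreExcess ∧ ShelteredFarCharting ∧ NormalCorePricing ∧ TailDriftBound ∧ ShelteredLabelling ∧ ScaleBadFloor ⇒ FarAggregatePricing 12 (1/25) (1/2000) (1/(2·10⁷))`
— Z2 (CERT) · Zr‴a (M) · Zr‴b (S) · Z3a (S/M) · LAB (M · rank 2) · Z4″ (M+CERT). [this file] -/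
theorem farAggregatePricing_record_of_leaves_v13
    (h2 : FarCoreExcess (1 / 25) (1 / 2000) (1 / (2 * 10 ^ 7)))
    (hra : ShelteredFarCharting (1 / 25) (1 / 2000)) (hrb : NormalCorePricing (1 / 25))
    (h3a : TailDriftBound (1 / 25) (1 / 2000)) (hL : ShelteredLabelling (1 / 25) (1 / 2000))
    (h4 : ScaleBadFloor (1 / 25) (1 / (2 * 10 ^ 7))) :
    FarAggregatePricing 12 (1 / 25) (1 / 2000) (1 / (2 * 10 ^ 7)) :=
  farAggregatePricing_record_of_leaves_v12 h2 hra hrb h3a hL labelDriftBound_holds h4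

/-! ## §2  (β′) R_aff at frame tolerance `1/25` and the bridge -/

/-- **R_aff′ · `AffineChartStraightening'`** (critic row 866 (iv), ruling β′ · TRUE-type · ATTACKABLE-M): the tree's R_aff
`AffineChartStraightening` VERBATIM with the frame-tolerance range widened from `θ ≤ 1/50` to `θ ≤ 1/25` (the slot's `θ`), so that it APPLIES on the
slot's good class `AffDeepReg 12 ε₁ (1/25) (1/450)`.  Strictly stronger than R_aff (`affineChartStraightening_of_prime`).  Why it might fail: only if a
`(1/25)`-framed two-shell environment admitted two affinely inequivalent fcc/hcp readings — excluded while `3θ√2 < 1/2` (`θ = 1/25`: `0.17`).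
[FJM 2002; Schmidt 2009; Braun–Schmidt 2013 (shape); critic row 866] -/
def AffineChartStraightening' : Prop :=
  ∃ C : ℝ, 0 ≤ C ∧ ∀ (ρ ε₁ θ : ℝ), 4 ≤ ρ → 0 < ε₁ → 0 ≤ θ → θ ≤ 1 / 25 → C * ρ ^ 2 * ε₁ ≤ 1 / 100 →
    ∀ (N : ℕ) (y : Fin N → EuclideanSpace ℝ (Fin 3)) (i : Fin N), Function.Injective y → AffDeepReg ρ ε₁ θ (1 / 450) y i →
      ∃ (a₀ : ℝ) (B : EuclideanSpace ℝ (Fin 3) →ₗ[ℝ] EuclideanSpace ℝ (Fin 3))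
        (Q₀ : EuclideanSpace ℝ (Fin 3) →ₗᵢ[ℝ] EuclideanSpace ℝ (Fin 3)) (z : Fin N → EuclideanSpace ℝ (Fin 3)),
        |a₀ - nearestDist y i| ≤ C * ε₁ * nearestDist y i ∧
        (∀ v : EuclideanSpace ℝ (Fin 3), ‖B v - Q₀ v‖ ≤ (2 * θ + C * ε₁) * ‖v‖) ∧
        (∀ j, dist (z j) (y j) ≤ C * ρ ^ 2 * ε₁ * nearestDist y i) ∧
        ∀ j, dist (y j) (y i) ≤ (ρ - 3) * nearestDist y i →
          ∃ (A : EuclideanSpace ℝ (Fin 3) →ₗᵢ[ℝ] EuclideanSpace ℝ (Fin 3)) (P : Finset (EuclideanSpace ℝ (Fin 3))),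
            (P = fccTwoShellPattern ∨ P = hcpTwoShellPattern) ∧
            (∀ v ∈ P, ∃ k, z k = z j + a₀ • B (A v)) ∧
            ∀ k, k ≠ j → dist (z k) (z j) ≤ 3 / 2 * a₀ → ∃ v ∈ P, z k = z j + a₀ • B (A v)

/-- **The bridge (PROVED)**: R_aff′ ⇒ R_aff (`θ ≤ 1/50 ≤ 1/25`). [this file] -/
theorem affineChartStraightening_of_prime (h : AffineChartStraightening') : AffineChartStraightening := by
  obtain ⟨C, hC, H⟩ := h
  exact ⟨C, hC, fun ρ ε₁ θ hρ hε₁ hθ hθ' hsmall =>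
    H ρ ε₁ θ hρ hε₁ hθ (hθ'.trans (by norm_num)) hsmall⟩

/-! ## §3  (β′) The far leaves re-typed over R_aff′, with bridges -/

/-- **LAB′ · `ShelteredLabelling' θ θ₀`** (β′ re-typing of LAB `ShelteredLabelling`, critic row 866 (iv)): the body of LAB VERBATIM behind the
premise `AffineChartStraightening'` — USABLE on the good class at `θ = 1/25` — instead of `AffineChartStraightening`.  `LAB → LAB′`
(`shelteredLabelling'_of`) and `LAB′ ∧ R_aff′ → LAB` (`shelteredLabelling_of_prime`).  Might fail: as LAB (memo NODE-g54b §3). [this file] -/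
def ShelteredLabelling' (θ θ₀ : ℝ) : Prop :=
  AffineChartStraightening' → ∀ C : ℝ, 0 ≤ C → ∃ lam lam' C₁ c₀ εL : ℝ, 1 ≤ lam ∧ 1 ≤ lam' ∧ 0 < C₁ ∧ 0 ≤ c₀ ∧ 0 < εL ∧
    ∀ ε₁ : ℝ, 0 < ε₁ → ε₁ ≤ εL → ∀ δ : ℝ, 0 < δ → δ ≤ 2 →
      ∀ (N : ℕ) (y : Fin N → EuclideanSpace ℝ (Fin 3)), Function.Injective y →
        ∀ i ∈ farSet θ₀ 12 ε₁ θ δ y \ goodScaleBadSet 12 ε₁ θ δ y, ∀ c : Chart, IsChart C ε₁ y i c → ChartAdmissible θ c →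
          ∀ R : ℝ, 1 ≤ R → C₁ * ε₁ * R ^ 2 ≤ 1 → Sheltered (lam * R) 12 ε₁ θ δ y i →
            ∃ (c' : Chart) (M : Finset (Fin N)) (π : Fin N → EuclideanSpace ℝ (Fin 3)) (ρ : ℝ)
              (L : Fin N → (EuclideanSpace ℝ (Fin 3) →ₗ[ℝ] EuclideanSpace ℝ (Fin 3))),
              Recharts θ c c' ∧ M ⊆ goodSet 12 ε₁ θ δ y ∧ i ∈ M ∧ π i = 0 ∧ Set.InjOn π ↑M ∧
              (∀ k ∈ M, π k ∈ barlowStacking 1 (Real.sqrt (2 / 3)) c'.s ∧ ‖π k‖ ≤ ρ ∧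
                ‖π k‖ ≤ 2 * (dist (y k) (y i) / nearestDist y i) + 1) ∧
              ρ ≤ lam' * R ∧
              (∀ k ∈ goodSet 12 ε₁ θ δ y, dist (y k) (y i) ≤ R * nearestDist y i → k ∈ M ∧ ‖π k‖ + 2 ≤ ρ) ∧
              (∀ p ∈ barlowStacking 1 (Real.sqrt (2 / 3)) c'.s, ‖p‖ ≤ ρ → ∃ k ∈ M, π k = p) ∧
              L i = c'.a₀ • c'.B ∧
              ∀ k ∈ M, ‖π k‖ + 2 ≤ ρ → ∀ k' ∈ M, ‖π k' - π k‖ ≤ 2 →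
                ‖y k' - y k - L k (π k' - π k)‖ ≤ c₀ * ε₁ * nearestDist y i

/-- LAB ⇒ LAB′ (PROVED: the premise only got stronger). [this file] -/
theorem shelteredLabelling'_of {θ θ₀ : ℝ} (h : ShelteredLabelling θ θ₀) : ShelteredLabelling' θ θ₀ :=
  fun hR' => h (affineChartStraightening_of_prime hR')

/-- LAB′ ∧ R_aff′ ⇒ LAB (PROVED). [this file] -/
theorem shelteredLabelling_of_prime {θ θ₀ : ℝ} (h : ShelteredLabelling' θ θ₀) (hR' : AffineChartStraightening') :
    ShelteredLabelling θ θ₀ :=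
  fun _ => h hR'

/-- **Zr‴a′ · `ShelteredFarCharting' θ θ₀`** (β′ re-typing of Zr‴a `ShelteredFarCharting`): the body of Zr‴a VERBATIM behind the premise
`AffineChartStraightening'`.  `Zr‴a → Zr‴a′` and `Zr‴a′ ∧ R_aff′ → Zr‴a`.  Might fail: as Zr‴a (…FarChartSplit). [this file] -/
def ShelteredFarCharting' (θ θ₀ : ℝ) : Prop :=
  AffineChartStraightening' → ∀ τ : ℝ, 0 < τ →
    ∃ R C εA : ℝ, 0 ≤ R ∧ 0 ≤ C ∧ 0 < εA ∧ ∀ ε₁ : ℝ, 0 < ε₁ → ε₁ ≤ εA → ∀ δ : ℝ, 0 < δ → δ ≤ 2 →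
      ∀ (N : ℕ) (y : Fin N → EuclideanSpace ℝ (Fin 3)), Function.Injective y →
        ∀ i ∈ shelteredFarSet R θ₀ 12 ε₁ θ δ y,
          ∃ c : Chart, IsChart C ε₁ y i c ∧ ChartAdmissible θ c ∧ PatternFar θ₀ τ c

/-- Zr‴a ⇒ Zr‴a′ (PROVED). [this file] -/
theorem shelteredFarCharting'_of {θ θ₀ : ℝ} (h : ShelteredFarCharting θ θ₀) : ShelteredFarCharting' θ θ₀ :=
  fun hR' => h (affineChartStraightening_of_prime hR')

/-- Zr‴a′ ∧ R_aff′ ⇒ Zr‴a (PROVED). [this file] -/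
theorem shelteredFarCharting_of_prime {θ θ₀ : ℝ} (h : ShelteredFarCharting' θ θ₀) (hR' : AffineChartStraightening') :
    ShelteredFarCharting θ θ₀ :=
  fun _ => h hR'

/-! ## §4  ★ Slot Z, the re-typed record v13′ -/

/-- ★ **SLOT Z, RECORD v13′ (β′ re-typing)**:
`AffineChartStraightening' → FarCoreExcess → ShelteredFarCharting' → NormalCorePricing → TailDriftBound → ShelteredLabelling' → ScaleBadFloor →
FarAggregatePricing 12 (1/25) (1/2000) (1/(2·10⁷))` — R_aff′ (M; the re-pointed R_aff item) · Z2 (CERT) · Zr‴a′ (M) · Zr‴b (S) · Z3a (S/M) · LAB′ (M · rank 2) ·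
Z4″ (M+CERT). [this file] -/
theorem farAggregatePricing_record_of_leaves_v13' (hR' : AffineChartStraightening')
    (h2 : FarCoreExcess (1 / 25) (1 / 2000) (1 / (2 * 10 ^ 7)))
    (hra' : ShelteredFarCharting' (1 / 25) (1 / 2000)) (hrb : NormalCorePricing (1 / 25))
    (h3a : TailDriftBound (1 / 25) (1 / 2000)) (hL' : ShelteredLabelling' (1 / 25) (1 / 2000))
    (h4 : ScaleBadFloor (1 / 25) (1 / (2 * 10 ^ 7))) :
    FarAggregatePricing 12 (1 / 25) (1 / 2000) (1 / (2 * 10 ^ 7)) :=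
  farAggregatePricing_record_of_leaves_v13 h2 (shelteredFarCharting_of_prime hra' hR') hrb h3a
    (shelteredLabelling_of_prime hL' hR') h4

end Summit.AtomisticToContinuum.Crystallization.Theorems.OverbindingBudgetAffineFarSmoothSplit
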